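import Mathlib
import HarnessLib
import Summits.HubbardSuperconductivity.HubbardSuperconductivity.Theorems.KLProgrammeKLRegimeIntegerTangent

/-!
# Route `KLProgramme` — engine support (route (L2)): the rounded integer frame vector has Euclidean length at least `R − 1`

Cell `gate-hubbard-kl`, seat hubbard-kl-k3c2-p3; gen-4 ENGINE child stmt-HubbardSuperconductivity-19855 (`stub_engine_step_norms`, propagator
`α_n`).  Companion of `KLProgrammeKLRegimeIntegerTangent`: for a unit vector `u` and `R ≥ 2`, `v_j = round(R u_j)` satisfies
`√(v₀² + v₁²) ≥ R − 1` (coordinate errors `≤ ½`, Cauchy–Schwarz in `ℝ²`) — the lower bound that keeps the anisotropic weight terms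
`2√2/(s|v|)` of `sum_inv_additiveQuarticWeight_le` uniform over sector pairs.  Also `√(v₀² + v₁²) ≤ R + 1`.  Everything is proved. [folklore]
-/

noncomputable section

namespace Summit.HubbardSuperconductivity.HubbardSuperconductivity.Theorems.TorusFourierL2

set_option linter.dupNamespace false -- summit = problem name (single-conjunct summit), D-0017

/-- **Lower bound of the rounded vector's length**: `(R − 1)² ≤ v₀² + v₁²` for a unit `u` and `R ≥ 2`. [folklore] -/
theorem sq_sub_one_le_sum_sq_round {R : ℝ} (hR : 2 ≤ R) {u : Fin 2 → ℝ} (hu : u 0 ^ 2 + u 1 ^ 2 = 1) :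
    (R - 1) ^ 2 ≤ ((round (R * u 0) : ℤ) : ℝ) ^ 2 + ((round (R * u 1) : ℤ) : ℝ) ^ 2 := by
  set δ₀ : ℝ := ((round (R * u 0) : ℤ) : ℝ) - R * u 0 with hδ₀
  set δ₁ : ℝ := ((round (R * u 1) : ℤ) : ℝ) - R * u 1 with hδ₁
  have h0 : |δ₀| ≤ 1 / 2 := abs_intCast_round_sub_le R u 0
  have h1 : |δ₁| ≤ 1 / 2 := abs_intCast_round_sub_le R u 1
  have e0 : ((round (R * u 0) : ℤ) : ℝ) = R * u 0 + δ₀ := by rw [hδ₀]; ring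
  have e1 : ((round (R * u 1) : ℤ) : ℝ) = R * u 1 + δ₁ := by rw [hδ₁]; ring
  rw [e0, e1]
  -- Cauchy–Schwarz: `(u·δ)² ≤ |δ|² ≤ 1/2`, so `u·δ ≥ -3/4`
  have hd0 : δ₀ ^ 2 ≤ 1 / 4 := by
    have := (sq_abs δ₀).symm ▸ pow_le_pow_left₀ (abs_nonneg δ₀) h0 2; nlinarith
  have hd1 : δ₁ ^ 2 ≤ 1 / 4 := by
    have := (sq_abs δ₁).symm ▸ pow_le_pow_left₀ (abs_nonneg δ₁) h1 2; nlinarith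
  have hCS : (u 0 * δ₀ + u 1 * δ₁) ^ 2 ≤ 1 / 2 := by
    nlinarith [sq_nonneg (u 0 * δ₁ - u 1 * δ₀)]
  have hdot : -(3 / 4) ≤ u 0 * δ₀ + u 1 * δ₁ := by nlinarith [sq_nonneg (u 0 * δ₀ + u 1 * δ₁ + 3 / 4)]
  have hR0 : 0 ≤ R := by linarith
  nlinarith [sq_nonneg δ₀, sq_nonneg δ₁]

/-- **`√(v₀² + v₁²) ≥ R − 1`.** [folklore] -/
theorem sub_one_le_sqrt_sum_sq_round {R : ℝ} (hR : 2 ≤ R) {u : Fin 2 → ℝ} (hu : u 0 ^ 2 + u 1 ^ 2 = 1) :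
    R - 1 ≤ Real.sqrt (((round (R * u 0) : ℤ) : ℝ) ^ 2 + ((round (R * u 1) : ℤ) : ℝ) ^ 2) := by
  rw [← Real.sqrt_sq (by linarith : (0 : ℝ) ≤ R - 1)]
  exact Real.sqrt_le_sqrt (sq_sub_one_le_sum_sq_round hR hu)

/-- **Upper bound**: `√(v₀² + v₁²) ≤ R + 1` (`R ≥ 0`). [folklore] -/
theorem sqrt_sum_sq_round_le {R : ℝ} (hR : 0 ≤ R) {u : Fin 2 → ℝ} (hu : u 0 ^ 2 + u 1 ^ 2 = 1) :
    Real.sqrt (((round (R * u 0) : ℤ) : ℝ) ^ 2 + ((round (R * u 1) : ℤ) : ℝ) ^ 2) ≤ R + 1 := by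
  set δ₀ : ℝ := ((round (R * u 0) : ℤ) : ℝ) - R * u 0 with hδ₀
  set δ₁ : ℝ := ((round (R * u 1) : ℤ) : ℝ) - R * u 1 with hδ₁
  have h0 : |δ₀| ≤ 1 / 2 := abs_intCast_round_sub_le R u 0
  have h1 : |δ₁| ≤ 1 / 2 := abs_intCast_round_sub_le R u 1
  have e0 : ((round (R * u 0) : ℤ) : ℝ) = R * u 0 + δ₀ := by rw [hδ₀]; ring
  have e1 : ((round (R * u 1) : ℤ) : ℝ) = R * u 1 + δ₁ := by rw [hδ₁]; ring
  rw [e0, e1, ← Real.sqrt_sq (by linarith : (0 : ℝ) ≤ R + 1)]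
  apply Real.sqrt_le_sqrt
  have hd0 : δ₀ ^ 2 ≤ 1 / 4 := by
    have := (sq_abs δ₀).symm ▸ pow_le_pow_left₀ (abs_nonneg δ₀) h0 2; nlinarith
  have hd1 : δ₁ ^ 2 ≤ 1 / 4 := by
    have := (sq_abs δ₁).symm ▸ pow_le_pow_left₀ (abs_nonneg δ₁) h1 2; nlinarith
  have hCS : (u 0 * δ₀ + u 1 * δ₁) ^ 2 ≤ 1 / 2 := by
    nlinarith [sq_nonneg (u 0 * δ₁ - u 1 * δ₀)]
  have hdot : u 0 * δ₀ + u 1 * δ₁ ≤ 3 / 4 := by nlinarith [sq_nonneg (u 0 * δ₀ + u 1 * δ₁ - 3 / 4)]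
  nlinarith [sq_nonneg δ₀, sq_nonneg δ₁]

end Summit.HubbardSuperconductivity.HubbardSuperconductivity.Theorems.TorusFourierL2

end
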